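import Summits.AtomisticToContinuum.BoseEinsteinCondensation.Theorems.BECCellInformationCoarseChainRule
import HarnessLib

/-!
# Crux `OneBodyEntropyBound` (stmt-AtomisticToContinuum-13440), line `registered`: stub `stub_blockMass`

Route `BECCellInformation`, problem `BoseEinsteinCondensation` of the summit `AtomisticToContinuum`;
support file for the line's skeleton (namespace `…Cruxes.OneBodyEntropyBound.Birth`).

**Statement** (`stub_blockMass`, the BLOCK MASS BOUND): let `Ψ` be an `(n+1)`-boson Dirichlet
trial state in the box `Λ_L = (0,L)³`, tiled by the `M³` half-open cells
`Q_k = Π_j [k_j s, (k_j + 1) s)`, `k : Fin 3 → Fin M`, of side `s = L/M`. If the one-body mass of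
particle `0` in every cell is `≤ P`, then its mass in the open `3 × 3 × 3` block
`Π_j (k₀_j s - s, k₀_j s + 2 s)` around the cell `k₀` is `≤ 27 P`.

**Proof.** Pointwise in `X`: wherever `Ψ X ≠ 0`, `X ∈ Λ_L^{n+1}` (Dirichlet condition), so
`X 0 ∈ Λ_L ⊆ ⋃_k Q_k` (`CoarseChainRule.exists_mem_cell`) lies in some cell `Q_k`; if moreover
`X 0` lies in the block then `|k_j - k₀_j| ≤ 1` for all `j` (divide by `s > 0`), i.e. `k` is one
of the at most `27` indices "near" `k₀`. Hence the block indicator is dominated by the sum of the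
cell indicators over the near indices; integrate (`lintegral_finsetSum`), bound each cell mass by
`P`, and count (an injection of the near indices into `Fin 3 → Fin 3`).
-/

noncomputable section

namespace Summit.AtomisticToContinuum.BoseEinsteinCondensation.Cruxes.OneBodyEntropyBound.Birth

open MeasureTheory Set
open scoped ENNReal NNReal
open Literature.MathematicalPhysics.QuantumManyBody.BoseGas
open Summit.AtomisticToContinuum.BoseEinsteinCondensation.Theorems

namespace BlockMass

/-- A point of the slab `[a s, (a+1) s)` lying in the window `(b s - s, b s + 2 s)` (`s > 0`) has
`|a - b| ≤ 1`. [folklore] -/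
theorem near_of_mem_Ico_of_mem_Ioo {s x : ℝ} (hs : 0 < s) {a b : ℕ}
    (h1 : x ∈ Set.Ico ((a : ℝ) * s) (((a : ℝ) + 1) * s))
    (h2 : x ∈ Set.Ioo ((b : ℝ) * s - s) ((b : ℝ) * s + 2 * s)) :
    b ≤ a + 1 ∧ a ≤ b + 1 := by
  obtain ⟨h1l, h1r⟩ := h1
  obtain ⟨h2l, h2r⟩ := h2
  have h3 : (a : ℝ) < b + 2 := by
    by_contra h
    have h' : ((b : ℝ) + 2) * s ≤ a * s := mul_le_mul_of_nonneg_right (not_lt.1 h) hs.le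
    linarith
  have h4 : (b : ℝ) < a + 2 := by
    by_contra h
    have h' : ((a : ℝ) + 2) * s ≤ b * s := mul_le_mul_of_nonneg_right (not_lt.1 h) hs.le
    linarith
  have h3' : a < b + 2 := by exact_mod_cast h3
  have h4' : b < a + 2 := by exact_mod_cast h4
  exact ⟨by omega, by omega⟩

/-- There are at most `27 = 3³` cell indices `k : Fin 3 → Fin M` with `|k_j - k₀_j| ≤ 1` for all
`j`. [folklore] -/
theorem card_near_le (M : ℕ) (k₀ : Fin 3 → Fin M) :
    (Finset.univ.filter fun k : Fin 3 → Fin M =>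
        ∀ j, (k₀ j : ℕ) ≤ (k j : ℕ) + 1 ∧ (k j : ℕ) ≤ (k₀ j : ℕ) + 1).card ≤ 27 := by
  have h27 : (Finset.univ : Finset (Fin 3 → Fin 3)).card = 27 := by
    rw [Finset.card_univ, Fintype.card_fun, Fintype.card_fin]
    norm_num
  rw [← h27]
  refine Finset.card_le_card_of_injOn
    (fun k j => (⟨((k j : ℕ) + 1 - (k₀ j : ℕ)) % 3, Nat.mod_lt _ (by norm_num)⟩ : Fin 3))
    (fun _ _ => Finset.mem_coe.2 (Finset.mem_univ _)) ?_
  intro k hk k' hk' h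
  rw [Finset.mem_coe, Finset.mem_filter] at hk hk'
  funext j
  have hj := congr_fun h j
  simp only [Fin.mk.injEq] at hj
  obtain ⟨hk1, hk2⟩ := hk.2 j
  obtain ⟨hk1', hk2'⟩ := hk'.2 j
  apply Fin.ext
  omega

/-- **Pointwise block bound.** For a Dirichlet trial state `Ψ` in `Λ_L`, `L = M s`, `s > 0`: the
density `|Ψ X|²` restricted to `X 0 ∈ Π_j (k₀_j s - s, k₀_j s + 2 s)` is dominated by the sum, over
the cell indices `k` near `k₀`, of the density restricted to `X 0 ∈ Q_k`. [folklore] -/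
theorem indicator_block_mul_le_sum {n : ℕ} {L s : ℝ} (hs : 0 < s) {M : ℕ} (hML : (M : ℝ) * s = L)
    (Ψ : TrialState (n + 1) L) (k₀ : Fin 3 → Fin M) (X : Config (n + 1)) :
    {y : Space | ∀ j, y j ∈ Set.Ioo (((k₀ j : ℕ) : ℝ) * s - s)
        (((k₀ j : ℕ) : ℝ) * s + 2 * s)}.indicator (fun _ => (1 : ℝ≥0∞)) (X 0) *
        (‖Ψ.ψ X‖₊ : ℝ≥0∞) ^ 2 ≤
      ∑ k ∈ Finset.univ.filter (fun k : Fin 3 → Fin M =>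
          ∀ j, (k₀ j : ℕ) ≤ (k j : ℕ) + 1 ∧ (k j : ℕ) ≤ (k₀ j : ℕ) + 1),
        {y : Space | ∀ j, y j ∈ Set.Ico (((k j : ℕ) : ℝ) * s)
          ((((k j : ℕ) : ℝ) + 1) * s)}.indicator (fun _ => (1 : ℝ≥0∞)) (X 0) *
          (‖Ψ.ψ X‖₊ : ℝ≥0∞) ^ 2 := by
  by_cases hΨ : Ψ.ψ X = 0
  · simp [hΨ]
  by_cases hXB : X 0 ∈ {y : Space | ∀ j, y j ∈ Set.Ioo (((k₀ j : ℕ) : ℝ) * s - s)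
      (((k₀ j : ℕ) : ℝ) * s + 2 * s)}
  swap
  · rw [Set.indicator_of_notMem hXB, zero_mul]
    exact zero_le
  -- `Ψ X ≠ 0` forces `X ∈ Λ_L^{n+1}`, so `X 0 ∈ Λ_L` lies in some cell `Q_k`
  have hXbox : X ∈ boxN (n + 1) L := by
    by_contra h
    exact hΨ (Ψ.eq_zero X h)
  have hx : X 0 ∈ box L := hXbox 0
  have hM : 0 < M := Fin.pos (k₀ 0)
  have hMr : (0 : ℝ) < M := Nat.cast_pos.2 hM
  have hL : 0 < L := hML ▸ mul_pos hMr hs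
  have hsLM : L / M = s := by
    rw [← hML, mul_div_cancel_left₀ s hMr.ne']
  obtain ⟨k, hk⟩ := CoarseChainRule.exists_mem_cell hL hM hx
  rw [hsLM] at hk
  have hkQ : X 0 ∈ {y : Space | ∀ j, y j ∈ Set.Ico (((k j : ℕ) : ℝ) * s)
      ((((k j : ℕ) : ℝ) + 1) * s)} := hk
  -- the cell index `k` is near `k₀`
  have hkNear : k ∈ Finset.univ.filter (fun k : Fin 3 → Fin M =>
      ∀ j, (k₀ j : ℕ) ≤ (k j : ℕ) + 1 ∧ (k j : ℕ) ≤ (k₀ j : ℕ) + 1) := by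
    rw [Finset.mem_filter]
    exact ⟨Finset.mem_univ _, fun j => near_of_mem_Ico_of_mem_Ioo hs (hk j) (hXB j)⟩
  rw [Set.indicator_of_mem hXB]
  refine le_trans (le_of_eq ?_) (Finset.single_le_sum (f := fun k' : Fin 3 → Fin M =>
    {y : Space | ∀ j, y j ∈ Set.Ico (((k' j : ℕ) : ℝ) * s)
      ((((k' j : ℕ) : ℝ) + 1) * s)}.indicator (fun _ => (1 : ℝ≥0∞)) (X 0) *
      (‖Ψ.ψ X‖₊ : ℝ≥0∞) ^ 2) (fun _ _ => zero_le) hkNear)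
  simp only [Set.indicator_of_mem hkQ]

end BlockMass

/-- **Block mass bound** (`stub_blockMass`). For an `(n+1)`-boson Dirichlet trial state `Ψ` in
`Λ_L`, `L = M s`, `s > 0`: if the one-body mass of particle `0` in every cell
`Q_k = Π_j [k_j s, (k_j+1) s)` is `≤ P`, then its mass in the open `3 × 3 × 3` block
`Π_j (k₀_j s - s, k₀_j s + 2 s)` around the cell `k₀` is `≤ 27 P` (the block meets at most `27`
cells, and `Ψ` vanishes off the tiled box). [folklore] -/
theorem stub_blockMass :
    ∀ (n : ℕ) (L s : ℝ), 0 < s → ∀ (M : ℕ), (M : ℝ) * s = L →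
      ∀ (Ψ : Literature.MathematicalPhysics.QuantumManyBody.BoseGas.TrialState (n + 1) L) (k₀ : Fin 3 → Fin M)
        (P : ENNReal),
        (∀ k : Fin 3 → Fin M, ∫⁻ X : Literature.MathematicalPhysics.QuantumManyBody.BoseGas.Config (n + 1),
            ({y : EuclideanSpace ℝ (Fin 3) | ∀ j, y j ∈ Set.Ico (((k j : ℕ) : ℝ) * s) ((((k j : ℕ) : ℝ) + 1) * s)}).indicator
              (fun _ => (1 : ENNReal)) (X 0) * (‖Ψ.ψ X‖₊ : ENNReal) ^ 2 ≤ P) →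
        ∫⁻ X : Literature.MathematicalPhysics.QuantumManyBody.BoseGas.Config (n + 1),
            ({y : EuclideanSpace ℝ (Fin 3) | ∀ j, y j ∈ Set.Ioo (((k₀ j : ℕ) : ℝ) * s - s) (((k₀ j : ℕ) : ℝ) * s + 2 * s)}).indicator
              (fun _ => (1 : ENNReal)) (X 0) * (‖Ψ.ψ X‖₊ : ENNReal) ^ 2 ≤ 27 * P := by
  intro n L s hs M hML Ψ k₀ P hP
  -- measurability of the cell-restricted densities
  have hmeas : ∀ k ∈ Finset.univ.filter (fun k : Fin 3 → Fin M =>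
      ∀ j, (k₀ j : ℕ) ≤ (k j : ℕ) + 1 ∧ (k j : ℕ) ≤ (k₀ j : ℕ) + 1),
      Measurable fun X : Config (n + 1) =>
        {y : Space | ∀ j, y j ∈ Set.Ico (((k j : ℕ) : ℝ) * s)
          ((((k j : ℕ) : ℝ) + 1) * s)}.indicator (fun _ => (1 : ℝ≥0∞)) (X 0) *
          (‖Ψ.ψ X‖₊ : ℝ≥0∞) ^ 2 := fun k _ =>
    ((measurable_const.indicator (CoarseChainRule.measurableSet_cell s k)).comp
      (measurable_pi_apply 0)).mul (measurable_normSq Ψ.contDiff.continuous)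
  -- at most `27` near indices
  have hcard : ((Finset.univ.filter (fun k : Fin 3 → Fin M =>
      ∀ j, (k₀ j : ℕ) ≤ (k j : ℕ) + 1 ∧ (k j : ℕ) ≤ (k₀ j : ℕ) + 1)).card : ℝ≥0∞) ≤ 27 := by
    exact_mod_cast BlockMass.card_near_le M k₀
  calc ∫⁻ X : Config (n + 1), {y : Space | ∀ j, y j ∈ Set.Ioo (((k₀ j : ℕ) : ℝ) * s - s)
          (((k₀ j : ℕ) : ℝ) * s + 2 * s)}.indicator (fun _ => (1 : ℝ≥0∞)) (X 0) *
          (‖Ψ.ψ X‖₊ : ℝ≥0∞) ^ 2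
      ≤ ∫⁻ X : Config (n + 1), ∑ k ∈ Finset.univ.filter (fun k : Fin 3 → Fin M =>
            ∀ j, (k₀ j : ℕ) ≤ (k j : ℕ) + 1 ∧ (k j : ℕ) ≤ (k₀ j : ℕ) + 1),
          {y : Space | ∀ j, y j ∈ Set.Ico (((k j : ℕ) : ℝ) * s)
            ((((k j : ℕ) : ℝ) + 1) * s)}.indicator (fun _ => (1 : ℝ≥0∞)) (X 0) *
            (‖Ψ.ψ X‖₊ : ℝ≥0∞) ^ 2 :=
        lintegral_mono fun X => BlockMass.indicator_block_mul_le_sum hs hML Ψ k₀ X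
    _ = ∑ k ∈ Finset.univ.filter (fun k : Fin 3 → Fin M =>
            ∀ j, (k₀ j : ℕ) ≤ (k j : ℕ) + 1 ∧ (k j : ℕ) ≤ (k₀ j : ℕ) + 1),
          ∫⁻ X : Config (n + 1), {y : Space | ∀ j, y j ∈ Set.Ico (((k j : ℕ) : ℝ) * s)
            ((((k j : ℕ) : ℝ) + 1) * s)}.indicator (fun _ => (1 : ℝ≥0∞)) (X 0) *
            (‖Ψ.ψ X‖₊ : ℝ≥0∞) ^ 2 :=
        lintegral_finsetSum _ hmeas
    _ ≤ ∑ _k ∈ Finset.univ.filter (fun k : Fin 3 → Fin M =>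
            ∀ j, (k₀ j : ℕ) ≤ (k j : ℕ) + 1 ∧ (k j : ℕ) ≤ (k₀ j : ℕ) + 1), P :=
        Finset.sum_le_sum fun k _ => hP k
    _ = ((Finset.univ.filter (fun k : Fin 3 → Fin M =>
            ∀ j, (k₀ j : ℕ) ≤ (k j : ℕ) + 1 ∧ (k j : ℕ) ≤ (k₀ j : ℕ) + 1)).card : ℝ≥0∞) * P := by
        rw [Finset.sum_const, nsmul_eq_mul]
    _ ≤ 27 * P := by
        gcongr

end Summit.AtomisticToContinuum.BoseEinsteinCondensation.Cruxes.OneBodyEntropyBound.Birth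

end
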